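import Summits.AnomalousDissipation.AnomalousDissipation.Theses.SymmetricOrLoud

/-!
# Glue of the PlanarEjection split of `SymmetricOrLoud.ThreeDFractionOrLoud` (stmt-AnomalousDissipation-29278)

Sorry-free proof of the GLUE item `SymmetricOrLoud.ThreeDFractionOrLoudGlue` (stmt-AnomalousDissipation-30316):
`PlanarStatesEject → EjectionPersists → ThreeDFractionOrLoud` — modus ponens (`EjectionPersists` is by definition the
implication «planar states eject ⇒ R°», its hypothesis being the text of `PlanarStatesEject`).  No facts asserted.
Source: decomp-ad cell, lens-4 g7 node «PlanarEjection» (kernel `run/shared/lean/pub/decomp-ad/decomp-ad-lens-4/g7/PlanarEjection.lean`,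
theorem `threeDFractionOrLoud_of_split`; also `threeDFractionOrLoudGlue_holds` in g8/ClassTrim.lean); landed by the cell's prover seat.
Nothing here proves the summit.
-/

set_option linter.dupNamespace false

namespace Summit.AnomalousDissipation.AnomalousDissipation.Theorems.PlanarEjectionGlue

open Summit.AnomalousDissipation.AnomalousDissipation.Theses
open Summit.AnomalousDissipation.AnomalousDissipation.Theses.SymmetricOrLoud

/-- GLUE item 30316 `ThreeDFractionOrLoudGlue`: modus ponens. [folklore] -/
theorem threeDFractionOrLoudGlue_holds : ThreeDFractionOrLoudGlue :=
  fun hP hX => hX hP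

end Summit.AnomalousDissipation.AnomalousDissipation.Theorems.PlanarEjectionGlue
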